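import Mathlib
import HarnessLib
import Literature.MathematicalPhysics.StatisticalMechanics.LennardJonesClusters
import Literature.MathematicalPhysics.StatisticalMechanics.StablePotentialsProofs
import Summits.AtomisticToContinuum.Crystallization.Theorems.GrainPercolationDialCrossCeiling
import Summits.AtomisticToContinuum.Crystallization.Theorems.OnePercentCertificate.Negative.TwoConeSABound

/-!
# LoopTunnelDial · crux T `PocketCase` (stmt-AtomisticToContinuum-27294) — LOCAL-SURGERY currency and the ORDER-1 SIEVE
(decomp-a2c lens-5 «finite/base range + asymptotic regime + bridge», generation 14; `--supports stmt-AtomisticToContinuum-27294`;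
sorry-free; imports only `Mathlib`, `HarnessLib`, Literature and LANDED Theorems files — no Theses file.)

The registered line v2 on T (HOME/decomp-a2c-lens-5/g12/line-pocket-nearfar.lean, 9d65d4e6…) and the banked preview v3 (914fdd82…)
state their NEAR/FAR floors in INTERNAL-ENERGY resp. REMOVAL currency: the trigger at test radius `R` must produce a ball chunk with a
VOLUME excess `κR³ − σR²`, and the PROVED bridge consumes it with ONE surgery — remove the whole ball — at the μ-stable staircase of order
`j = ⌈64R³⌉`.  Critic row 144 recorded the honest price of that currency: the bite radius `R_bite ≈ σ_W/κ ≈ 10²–10³` (σ_W ≈ 2.5 per R²,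
κ ≈ 0.026 for the vacancy superlattice, ≲ 5·10⁻³ for FAR matter) is far beyond the certified instrument range `R ≤ 12`: the floors are
asymptotic theorems.

THIS FILE types the weakest currency the bridge actually consumes and the order-1 end of the same dial, GS-free:

§1 VOCABULARY (stated UNFOLDED, no new `def`, D-0009). «`MuStable`», «`KinkBalanced`» verbatim from the registered skeleton; NEW «`Improvable e η R y c`»: SOME configuration `z` that
   coincides with `y` as a point set outside the closed `R`-ball about the particle `y c`, changes the particle number by at most `⌈64R³⌉`,
   and improves the grand potential at chemical potential `e` by `η`: `𝓔(z) + η ≤ 𝓔(y) + e·(M − N)`.  (A LOCAL SURGERY: heal a point defect,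
   recrystallise a compact debris cluster in registry, fill a small void, OR remove the ball — the prover chooses per texture.)
§2 THE BRIDGE ATOM (PROVED): `(e, ε, j)`-μ-stability with `⌈64R³⌉ ≤ j` and `ε < η` forbids `Improvable e η R y c` at every centre
   (`not_improvable_of_muStable`) — no cross constant, no separation, no ball count: the ORDER `j` of μ-stability is exactly the radius
   budget `64R³` of the surgeries it kills.  Monotonicity in `R`/`η` (`improvable_mono`).
§3 REMOVAL IS A LOCAL SURGERY (PROVED, 7/10-separated `y`, `R ≥ 1`): a removal-currency excess `W(B(c,R)) ≥ e·#B + η` gives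
   `Improvable e η R y c` (`improvable_of_chunkExcess`; window by the landed `ballChunk_card_le`).  Hence every v2/v3 floor implies the
   corresponding floor in surgery currency (the line-file kernels `nearI_of_nearW`, `floorEvI_of_floorEv` use exactly this lemma).
§4 ORDER ONE (PROVED, GS-free): one-particle surgeries.  `kinkBalanced_of_muStable`: μ-stability of any order `j ≥ 1` implies KINK
   BALANCE `(e, ε)` (every site energy `≤ e + ε`, every empty point binds by `≥ e − ε`; generation 9's Kossel relations, there proved only for
   GROUND STATES at window-minimal `N` via `E(n±1)`; here for ANY injective configuration from `MuStable` alone).  Conversely an ORDER-1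
   DEFECT is a radius-`R` improvement for every `R > 0`: a site bound by less than `|e| − η` (`improvable_of_le_siteEnergy`, delete it) or an
   empty point within `R` of `y c` binding by more than `|e| + η` (`improvable_of_insertion_le`, fill it).  So in surgery currency the NEAR
   floor is FREE on non-kink-balanced configurations and its whole content sits on the KINK-BALANCED world.
§5 CERTIFIED LEVEL FLOOR (PROVED from tree facts): any limit `e` of `E(N)/N` satisfies `−0.78647722 ≤ e`
   (`TwoConeSA.twoConeS_groundStateEnergy_ge` through the limit).  (The tree also has `e = e⋆ ≤ −0.7175`:
   `LoopTunnelDialCurrencyBridge.e_eq_eStar` with `OnePercentFccWindow.eStar_le`; not needed below and not imported.)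
§6 THE ORDER-1 SIEVE HAS TEETH (PROVED, GS-free, certified constants only): `V_LJ ≤ −2/25` on `[39/40, 103/100]` (and `V_LJ ≤ 0`
   beyond `9/10`, tree); hence at a kink-balanced configuration of level `e ≥ −0.78647722` and tolerance `ε ≤ 1/100`, NO empty point that is `9/10`-clear
   of particles is caged by `≥ 10` particles at distance within `3/100… ` of `1` — precisely, `#{k : 39/40 ≤ |q − y_k| ≤ 103/100} ≤ 9`
   (`cagedCount_le_of_kinkBalanced`): relaxed VACANCIES (12 cage neighbours), DIVACANCY sites (11) and TRIVACANCY sites (10) are absent.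
   With §4 this prunes the census's canonical NEAR specimen (vacancy superlattice, STATUS l.913: cert₂ = .957, far₂,₆ = 0) from the world
   on which the surgery-currency NEAR floor has content, at every μ-stable index of order ≥ 100 — by theorem, not by instrument.

LENS READING (generation 14).  The dial between «finite range» and «asymptotic regime» is the ORDER of μ-stability ≙ the RADIUS BUDGET of
local surgeries: order 1 = kink balance (instrumentable per texture by the census's site-energy / hole-depth tables, and §6 certifies the
vacancy class away); order `64R³` with healing surgeries bites at `R ≈` defect size + collar on compact-core textures (point defects,
debris, small voids, dislocation LOOPS healed by local rearrangement) — inside the certified range; extended SEALED WALLS admit no local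
healing and are priced only by removal (`R_bite ≈ σ_W·L/σ_wall`, asymptotic: the shared WallTension lever of lens-4 g15); FAR matter is the
declared residual (TetrahedralFrustration).  The bridge (`not_improvable_of_muStable` + the staircase) is PROVED at every order.
-/

noncomputable section

namespace Summit.AtomisticToContinuum.Crystallization.Theorems.LoopTunnelDialLocalSurgery

open scoped BigOperators Classical Topology
open Filter
open Literature.MathematicalPhysics.StatisticalMechanics
open Summit.AtomisticToContinuum.Crystallization.Theorems.GrainPercolationDialCrossCeiling
  (E3 restrictTo chunkEnergy ballChunk injective_of_sep ballChunk_card_le)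

variable {N : ℕ}

/-! ## §1 Vocabulary (NO new definitions — D-0009: everything below is stated UNFOLDED over Literature's `interactionEnergy` /
`siteEnergy` / `lennardJones` and the landed `restrictTo` / `chunkEnergy` / `ballChunk`; the line file on 27294 recovers its own
`MuStable` / `KinkBalanced` / `Improvable` by `Iff.rfl`)

* «`MuStable e ε j y`» ≡ `∀ M, N ≤ M + j → M ≤ N + j → ∀ z : Fin M → E3, injective z → 𝓔(y) + e (M − N) − ε ≤ 𝓔(z)`
  (registered skeleton, verbatim);
* «`KinkBalanced e ε y`» ≡ `(∀ i, 𝓔ⁱ(y) ≤ e + ε) ∧ ∀ h ∉ range y, e − ε ≤ Σ_i V(|h − y_i|)` (generation 9, verbatim);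
* «`Improvable e η R y c`» (NEW, the LOCAL-SURGERY currency) ≡ `∃ M (z : Fin M → E3), injective z ∧ (∀ k, R < |y_k − y_c| → y_k ∈ range z)
  ∧ (∀ l, R < |z_l − y_c| → z_l ∈ range y) ∧ N ≤ M + ⌈64R³⌉ ∧ M ≤ N + ⌈64R³⌉ ∧ 𝓔(z) + η ≤ 𝓔(y) + e (M − N)`: some injective
  configuration that coincides with `y` as a point set outside the closed `R`-ball about the particle `y c`, with `|M − N| ≤ ⌈64R³⌉`,
  improving the grand potential at chemical potential `e` by at least `η`. -/

/-! ## §2 The bridge atom: μ-stability of order `⌈64R³⌉` kills radius-`R` improvements -/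

/-- **BRIDGE ATOM (PROVED).** -/
theorem not_improvable_of_muStable {e ε η R : ℝ} {j : ℕ} {y : Fin N → E3}
    (hM : (∀ M : ℕ, N ≤ M + j → M ≤ N + j → ∀ z : Fin M → E3, Function.Injective z →
      interactionEnergy lennardJones y + e * ((M : ℝ) - N) - ε ≤ interactionEnergy lennardJones z))
    (hj : ⌈64 * R ^ 3⌉₊ ≤ j) (hεη : ε < η) (c : Fin N) :
    ¬ ∃ (M : ℕ) (z : Fin M → E3), Function.Injective z ∧
        (∀ k : Fin N, R < dist (y k) (y c) → y k ∈ Set.range z) ∧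
        (∀ l : Fin M, R < dist (z l) (y c) → z l ∈ Set.range y) ∧
        N ≤ M + ⌈64 * R ^ 3⌉₊ ∧ M ≤ N + ⌈64 * R ^ 3⌉₊ ∧
        interactionEnergy lennardJones z + η ≤ interactionEnergy lennardJones y + e * ((M : ℝ) - N) := by
  rintro ⟨M, z, hz, -, -, h1, h2, hE⟩
  have h := hM M (by omega) (by omega) z hz
  linarith

/-- Monotonicity: a radius-`R` improvement by `η` is a radius-`R'` improvement by `η'` for `R ≤ R'`, `η' ≤ η`. -/
theorem improvable_mono {e η η' R R' : ℝ} (hη : η' ≤ η) (hR : R ≤ R') (hR0 : 0 ≤ R) {y : Fin N → E3} {c : Fin N}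
    (h : ∃ (M : ℕ) (z : Fin M → E3), Function.Injective z ∧
        (∀ k : Fin N, R < dist (y k) (y c) → y k ∈ Set.range z) ∧
        (∀ l : Fin M, R < dist (z l) (y c) → z l ∈ Set.range y) ∧
        N ≤ M + ⌈64 * R ^ 3⌉₊ ∧ M ≤ N + ⌈64 * R ^ 3⌉₊ ∧
        interactionEnergy lennardJones z + η ≤ interactionEnergy lennardJones y + e * ((M : ℝ) - N)) :
    ∃ (M : ℕ) (z : Fin M → E3), Function.Injective z ∧
        (∀ k : Fin N, R' < dist (y k) (y c) → y k ∈ Set.range z) ∧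
        (∀ l : Fin M, R' < dist (z l) (y c) → z l ∈ Set.range y) ∧
        N ≤ M + ⌈64 * R' ^ 3⌉₊ ∧ M ≤ N + ⌈64 * R' ^ 3⌉₊ ∧
        interactionEnergy lennardJones z + η' ≤ interactionEnergy lennardJones y + e * ((M : ℝ) - N) := by
  obtain ⟨M, z, hz, hout, hin, h1, h2, hE⟩ := h
  have hceil : ⌈64 * R ^ 3⌉₊ ≤ ⌈64 * R' ^ 3⌉₊ := by
    apply Nat.ceil_mono
    have : R ^ 3 ≤ R' ^ 3 := pow_le_pow_left₀ hR0 hR 3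
    linarith
  refine ⟨M, z, hz, fun k hk => hout k (lt_of_le_of_lt hR hk), fun l hl => hin l (lt_of_le_of_lt hR hl), ?_, ?_, ?_⟩
  · omega
  · omega
  · linarith

/-! ## §3 Removal of a ball chunk is a local surgery -/

/-- Restriction to a particle set preserves injectivity. -/
theorem restrictTo_injective (S : Finset (Fin N)) {y : Fin N → E3} (hy : Function.Injective y) :
    Function.Injective (restrictTo S y) :=
  fun _ _ hab => (S.orderEmbOfFin rfl).injective (hy hab)

/-- **REMOVAL ⟹ IMPROVABLE (PROVED):** on a `7/10`-separated configuration, a removal-currency excess `e·#B(c,R) + η ≤ W(B(c,R))` at a radius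
`R ≥ 1` is a radius-`R` improvement by `η` (delete the ball; `|ΔN| = #B ≤ 64R³` by the landed ball count). -/
theorem improvable_of_chunkExcess {y : Fin N → E3} (hsep : ∀ a b : Fin N, a ≠ b → (7 : ℝ) / 10 ≤ dist (y a) (y b))
    {e η R : ℝ} (hR : 1 ≤ R) (c : Fin N)
    (h : e * ((ballChunk y c R).card : ℝ) + η ≤ chunkEnergy y (ballChunk y c R)) :
    ∃ (M : ℕ) (z : Fin M → E3), Function.Injective z ∧
        (∀ k : Fin N, R < dist (y k) (y c) → y k ∈ Set.range z) ∧
        (∀ l : Fin M, R < dist (z l) (y c) → z l ∈ Set.range y) ∧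
        N ≤ M + ⌈64 * R ^ 3⌉₊ ∧ M ≤ N + ⌈64 * R ^ 3⌉₊ ∧
        interactionEnergy lennardJones z + η ≤ interactionEnergy lennardJones y + e * ((M : ℝ) - N) := by
  set S : Finset (Fin N) := ballChunk y c R with hSdef
  have hy : Function.Injective y := injective_of_sep hsep
  have hSN : S.card ≤ N := by simpa using S.card_le_univ
  have hc : Sᶜ.card = N - S.card := by rw [Finset.card_compl, Fintype.card_fin]
  have hcardR : (S.card : ℝ) ≤ 64 * R ^ 3 := ballChunk_card_le hsep c hR
  have hcardj : S.card ≤ ⌈64 * R ^ 3⌉₊ := by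
    have : (S.card : ℝ) ≤ (⌈64 * R ^ 3⌉₊ : ℝ) := hcardR.trans (Nat.le_ceil _)
    exact_mod_cast this
  refine ⟨Sᶜ.card, restrictTo Sᶜ y, restrictTo_injective Sᶜ hy, fun k hk => ?_, fun l _ => ?_, by omega, by omega, ?_⟩
  · have hkS : k ∈ (Sᶜ : Finset (Fin N)) := by
      rw [Finset.mem_compl, hSdef]
      unfold ballChunk
      simp only [Finset.mem_filter, Finset.mem_univ, true_and, not_le]
      exact hk
    have hk' : k ∈ Set.range (Sᶜ.orderEmbOfFin rfl) := by
      rw [Finset.range_orderEmbOfFin]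
      exact hkS
    obtain ⟨l, hl⟩ := hk'
    exact ⟨l, by show y (Sᶜ.orderEmbOfFin rfl l) = y k; rw [hl]⟩
  · exact ⟨Sᶜ.orderEmbOfFin rfl l, rfl⟩
  · have hcast : ((Sᶜ.card : ℕ) : ℝ) = (N : ℝ) - S.card := by rw [hc, Nat.cast_sub hSN]
    have hW : chunkEnergy y S = interactionEnergy lennardJones y - interactionEnergy lennardJones (restrictTo Sᶜ y) := rfl
    rw [hcast]
    have : e * ((N : ℝ) - S.card - N) = -(e * S.card) := by ring
    rw [this]
    linarith

/-! ## §4 Order one: one-particle surgeries -/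

/-- Adjoining a particle: `𝓔(h :: y) = 𝓔(y) + Σ_i V(|h − y_i|)`. -/
theorem interactionEnergy_cons (h : E3) (y : Fin N → E3) :
    interactionEnergy lennardJones (Fin.cons h y : Fin (N + 1) → E3) =
      interactionEnergy lennardJones y + ∑ i : Fin N, lennardJones (dist h (y i)) := by
  set y' : Fin (N + 1) → E3 := Fin.cons h y with hy'
  have hsplit := interactionEnergy_eq_succAbove_add_siteEnergy lennardJones lennardJones_zero y' 0
  have hcomp : y' ∘ (0 : Fin (N + 1)).succAbove = y := by
    funext k
    simp [y']
  have hsite : siteEnergy lennardJones y' 0 = ∑ i : Fin N, lennardJones (dist h (y i)) := by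
    rw [siteEnergy_eq_sum_succAbove]
    simp [y']
  rw [hcomp, hsite] at hsplit
  exact hsplit

/-- **ORDER ONE ⟸ ORDER j (PROVED, GS-free):** μ-stability of any order `j ≥ 1` implies kink balance at the same level and tolerance. -/
theorem kinkBalanced_of_muStable {e ε : ℝ} {j : ℕ} {y : Fin N → E3}
    (hM : (∀ M : ℕ, N ≤ M + j → M ≤ N + j → ∀ z : Fin M → E3, Function.Injective z →
      interactionEnergy lennardJones y + e * ((M : ℝ) - N) - ε ≤ interactionEnergy lennardJones z)) (hj : 1 ≤ j)
    (hy : Function.Injective y) :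
    ((∀ i : Fin N, siteEnergy lennardJones y i ≤ e + ε) ∧
      ∀ h : E3, h ∉ Set.range y → e - ε ≤ ∑ i : Fin N, lennardJones (dist h (y i))) := by
  refine ⟨fun i => ?_, fun h hh => ?_⟩
  · -- removal of the particle `i`
    cases N with
    | zero => exact i.elim0
    | succ n =>
      have hsplit := interactionEnergy_eq_succAbove_add_siteEnergy lennardJones lennardJones_zero y i
      have hinj : Function.Injective (y ∘ i.succAbove) := hy.comp Fin.succAbove_right_injective
      have hval := hM n (by omega) (by omega) (y ∘ i.succAbove) hinj
      have hcast : e * ((n : ℝ) - ((n + 1 : ℕ) : ℝ)) = -e := by push_cast; ring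
      rw [hcast] at hval
      linarith
  · -- insertion of the empty point `h`
    have hinj : Function.Injective (Fin.cons h y : Fin (N + 1) → E3) := Fin.cons_injective_iff.2 ⟨hh, hy⟩
    have hval := hM (N + 1) (by omega) (by omega) (Fin.cons h y) hinj
    have hcast : e * (((N + 1 : ℕ) : ℝ) - (N : ℝ)) = e := by push_cast; ring
    rw [hcast, interactionEnergy_cons] at hval
    linarith

/-- **A LOOSE SITE is a local improvement (PROVED, GS-free):** a particle `i` within `R` of `y c` bound by at most `|e| − η`
(`e + η ≤ 𝓔ⁱ(y)`) — delete it. -/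
theorem improvable_of_le_siteEnergy {e η R : ℝ} {y : Fin N → E3} (hy : Function.Injective y) (hR : 0 < R) {i c : Fin N}
    (hic : dist (y i) (y c) ≤ R) (h : e + η ≤ siteEnergy lennardJones y i) :
    ∃ (M : ℕ) (z : Fin M → E3), Function.Injective z ∧
        (∀ k : Fin N, R < dist (y k) (y c) → y k ∈ Set.range z) ∧
        (∀ l : Fin M, R < dist (z l) (y c) → z l ∈ Set.range y) ∧
        N ≤ M + ⌈64 * R ^ 3⌉₊ ∧ M ≤ N + ⌈64 * R ^ 3⌉₊ ∧
        interactionEnergy lennardJones z + η ≤ interactionEnergy lennardJones y + e * ((M : ℝ) - N) := by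
  cases N with
  | zero => exact i.elim0
  | succ n =>
    have hsplit := interactionEnergy_eq_succAbove_add_siteEnergy lennardJones lennardJones_zero y i
    have hinj : Function.Injective (y ∘ i.succAbove) := hy.comp Fin.succAbove_right_injective
    have hceil : 1 ≤ ⌈64 * R ^ 3⌉₊ := Nat.one_le_iff_ne_zero.2 (by
      have : 0 < ⌈64 * R ^ 3⌉₊ := Nat.ceil_pos.2 (by positivity)
      omega)
    refine ⟨n, y ∘ i.succAbove, hinj, fun k hk => ?_, fun l _ => ⟨i.succAbove l, rfl⟩, by omega, by omega, ?_⟩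
    · have hki : k ≠ i := by
        rintro rfl
        exact absurd hic (not_le.2 hk)
      obtain ⟨b, hb⟩ := Fin.exists_succAbove_eq hki
      exact ⟨b, by simp [hb]⟩
    · have hcast : e * ((n : ℝ) - ((n + 1 : ℕ) : ℝ)) = -e := by push_cast; ring
      rw [hcast]
      linarith

/-- **A DEEP HOLE is a local improvement (PROVED, GS-free):** an empty point `h` within `R` of `y c` binding by at least `|e| + η`
(`Σ_i V(|h − y_i|) + η ≤ e`) — fill it. -/
theorem improvable_of_insertion_le {e η R : ℝ} {y : Fin N → E3} (hy : Function.Injective y) (hR : 0 < R) {h : E3} {c : Fin N}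
    (hh : h ∉ Set.range y) (hhc : dist h (y c) ≤ R) (hsum : (∑ i : Fin N, lennardJones (dist h (y i))) + η ≤ e) :
    ∃ (M : ℕ) (z : Fin M → E3), Function.Injective z ∧
        (∀ k : Fin N, R < dist (y k) (y c) → y k ∈ Set.range z) ∧
        (∀ l : Fin M, R < dist (z l) (y c) → z l ∈ Set.range y) ∧
        N ≤ M + ⌈64 * R ^ 3⌉₊ ∧ M ≤ N + ⌈64 * R ^ 3⌉₊ ∧
        interactionEnergy lennardJones z + η ≤ interactionEnergy lennardJones y + e * ((M : ℝ) - N) := by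
  have hinj : Function.Injective (Fin.cons h y : Fin (N + 1) → E3) := Fin.cons_injective_iff.2 ⟨hh, hy⟩
  have hceil : 1 ≤ ⌈64 * R ^ 3⌉₊ := Nat.one_le_iff_ne_zero.2 (by
    have : 0 < ⌈64 * R ^ 3⌉₊ := Nat.ceil_pos.2 (by positivity)
    omega)
  refine ⟨N + 1, Fin.cons h y, hinj, fun k _ => ⟨k.succ, by simp⟩, fun l hl => ?_, by omega, by omega, ?_⟩
  · refine Fin.cases ?_ (fun k => ?_) l hl
    · intro h0
      exact absurd hhc (not_le.2 (by simpa using h0))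
    · intro _
      exact ⟨k, by simp⟩
  · have hcast : e * (((N + 1 : ℕ) : ℝ) - (N : ℝ)) = e := by push_cast; ring
    rw [hcast, interactionEnergy_cons]
    linarith

/-- **Surgery-currency floors are FREE off the kink-balanced world (PROVED):** if `y` is NOT `(e, η)`-kink-balanced then either some
particle is a radius-`R` improvement centre for every `R > 0` (loose site), or some empty point binds by more than `|e| + η` (a deep hole,
an improvement about any particle within `R` of it). -/
theorem looseSite_or_deepHole_of_not_kinkBalanced {e η : ℝ} {y : Fin N → E3} (hy : Function.Injective y)
    (h : ¬ ((∀ i : Fin N, siteEnergy lennardJones y i ≤ e + η) ∧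
      ∀ h : E3, h ∉ Set.range y → e - η ≤ ∑ i : Fin N, lennardJones (dist h (y i)))) :
    (∃ i : Fin N, ∀ R : ℝ, 0 < R → ∃ (M : ℕ) (z : Fin M → E3), Function.Injective z ∧
          (∀ k : Fin N, R < dist (y k) (y i) → y k ∈ Set.range z) ∧
          (∀ l : Fin M, R < dist (z l) (y i) → z l ∈ Set.range y) ∧
          N ≤ M + ⌈64 * R ^ 3⌉₊ ∧ M ≤ N + ⌈64 * R ^ 3⌉₊ ∧
          interactionEnergy lennardJones z + η ≤ interactionEnergy lennardJones y + e * ((M : ℝ) - N)) ∨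
      ∃ q : E3, q ∉ Set.range y ∧ (∑ i : Fin N, lennardJones (dist q (y i))) + η < e := by
  rw [not_and_or] at h
  rcases h with h | h
  · left
    obtain ⟨i, hi⟩ := not_forall.1 h
    refine ⟨i, fun R hR => improvable_of_le_siteEnergy hy hR (by simp; exact hR.le) (le_of_lt (not_le.1 hi))⟩
  · right
    obtain ⟨q, hq⟩ := not_forall.1 h
    obtain ⟨hq1, hq2⟩ := Classical.not_imp.1 hq
    exact ⟨q, hq1, by linarith [not_le.1 hq2]⟩

/-! ## §5 The certified level floor -/

/-- **`−0.78647722 ≤ e` (PROVED):** any limit of `E(N)/N` is at least the tree's two-cone stability constant. -/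
theorem twoConeB_le_of_tendsto {e : ℝ} (he : Tendsto (fun N : ℕ => groundStateEnergy lennardJones 3 N / N) atTop (𝓝 e)) :
    -(98309653 / 125000000 : ℝ) ≤ e := by
  refine ge_of_tendsto he ?_
  filter_upwards [Filter.eventually_ge_atTop 1] with N hN
  have h := Summit.AtomisticToContinuum.Crystallization.Theorems.TwoConeSA.twoConeS_groundStateEnergy_ge N
  have hpos : (0 : ℝ) < (N : ℝ) := by exact_mod_cast hN
  rw [le_div_iff₀ hpos]
  linarith

/-! ## §6 The order-1 sieve has teeth: no caged holes at kink-balanced configurations -/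

/-- **`V_LJ ≤ −2/25` on the near-unit window `[39/40, 103/100]`** (`V + 2/25 = ((u − 1)² − 1/25)/12` with `u = r⁻⁶ ∈ [4/5, 6/5]`). -/
theorem lennardJones_le_of_window {r : ℝ} (h1 : 39 / 40 ≤ r) (h2 : r ≤ 103 / 100) : lennardJones r ≤ -(2 / 25) := by
  unfold lennardJones
  have h0 : 0 < r := by linarith
  have hinv0 : 0 ≤ r⁻¹ := inv_nonneg.2 h0.le
  have hup : r⁻¹ ≤ (39 / 40 : ℝ)⁻¹ := inv_anti₀ (by norm_num) h1
  have hlo : (103 / 100 : ℝ)⁻¹ ≤ r⁻¹ := inv_anti₀ h0 h2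
  have hu_up : (r⁻¹) ^ 6 ≤ ((39 / 40 : ℝ)⁻¹) ^ 6 := pow_le_pow_left₀ hinv0 hup 6
  have hu_lo : ((103 / 100 : ℝ)⁻¹) ^ 6 ≤ (r⁻¹) ^ 6 := pow_le_pow_left₀ (by positivity) hlo 6
  have hA : ((39 / 40 : ℝ)⁻¹) ^ 6 ≤ 6 / 5 := by norm_num
  have hB : 4 / 5 ≤ ((103 / 100 : ℝ)⁻¹) ^ 6 := by norm_num
  have h12 : (r⁻¹) ^ 12 = ((r⁻¹) ^ 6) ^ 2 := by ring
  rw [h12]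
  set u : ℝ := (r⁻¹) ^ 6 with hu
  have hu1 : u ≤ 6 / 5 := hu_up.trans hA
  have hu2 : 4 / 5 ≤ u := hB.trans hu_lo
  nlinarith

/-- **Insertion sums of clear points are bounded by the cage (PROVED, GS-free):** if the empty point `q` is `9/10`-clear of particles,
its insertion sum is at most `−(2/25)·#{k : 39/40 ≤ |q − y_k| ≤ 103/100}`. -/
theorem insertion_le_of_clear {y : Fin N → E3} {q : E3} (hclear : ∀ k : Fin N, 9 / 10 ≤ dist q (y k)) :
    ∑ i : Fin N, lennardJones (dist q (y i)) ≤
      -(2 / 25) * ((Finset.univ.filter fun k : Fin N => 39 / 40 ≤ dist q (y k) ∧ dist q (y k) ≤ 103 / 100).card : ℝ) := by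
  set T : Finset (Fin N) := Finset.univ.filter fun k : Fin N => 39 / 40 ≤ dist q (y k) ∧ dist q (y k) ≤ 103 / 100 with hT
  have hsplit := Finset.sum_add_sum_compl T fun i : Fin N => lennardJones (dist q (y i))
  have h1 : ∑ i ∈ T, lennardJones (dist q (y i)) ≤ ∑ i ∈ T, (-(2 / 25) : ℝ) := by
    refine Finset.sum_le_sum fun i hi => ?_
    have hi' := (Finset.mem_filter.1 hi).2
    exact lennardJones_le_of_window hi'.1 hi'.2
  -- `V_LJ ≤ 0` beyond `9/10` (`(10/9)⁶ < 2`; the tree's `PhononSlackCertificatesNearFarGlueR.lennardJones_nonpos_of_ge_nine_tenths`,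
  -- re-derived inline to keep this helper's import cone inside landed GS-free modules)
  have hnonpos : ∀ r : ℝ, 9 / 10 ≤ r → lennardJones r ≤ 0 := by
    intro r hr
    unfold lennardJones
    have h0 : 0 < r := by linarith
    have hinv : r⁻¹ ≤ (9 / 10 : ℝ)⁻¹ := inv_anti₀ (by norm_num) hr
    have hinv0 : 0 ≤ r⁻¹ := inv_nonneg.2 h0.le
    have ht : (r⁻¹) ^ 6 ≤ ((9 / 10 : ℝ)⁻¹) ^ 6 := pow_le_pow_left₀ hinv0 hinv 6
    have h2 : ((9 / 10 : ℝ)⁻¹) ^ 6 < 2 := by norm_num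
    have h12 : (r⁻¹) ^ 12 = ((r⁻¹) ^ 6) ^ 2 := by ring
    rw [h12]
    nlinarith [pow_nonneg hinv0 6]
  have h2 : ∑ i ∈ Tᶜ, lennardJones (dist q (y i)) ≤ 0 :=
    Finset.sum_nonpos fun i _ => hnonpos _ (hclear i)
  rw [Finset.sum_const, nsmul_eq_mul] at h1
  rw [← hsplit]
  linarith

/-- **NO CAGED HOLES AT KINK-BALANCED CONFIGURATIONS (PROVED, GS-free, certified constants):** at a kink-balanced configuration of level
`e ≥ −0.78647722` and tolerance `ε ≤ 1/100`, an empty point that is `9/10`-clear of particles has at most `9` particles at distance within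
`[39/40, 103/100]` — relaxed vacancies (12), divacancy sites (11) and trivacancy sites (10) do not occur. -/
theorem cagedCount_le_of_kinkBalanced {e ε : ℝ} {y : Fin N → E3}
    (hK : ((∀ i : Fin N, siteEnergy lennardJones y i ≤ e + ε) ∧
      ∀ h : E3, h ∉ Set.range y → e - ε ≤ ∑ i : Fin N, lennardJones (dist h (y i))))
    (he : -(98309653 / 125000000 : ℝ) ≤ e) (hε : ε ≤ 1 / 100) {q : E3} (hq : q ∉ Set.range y)
    (hclear : ∀ k : Fin N, 9 / 10 ≤ dist q (y k)) :
    (Finset.univ.filter fun k : Fin N => 39 / 40 ≤ dist q (y k) ∧ dist q (y k) ≤ 103 / 100).card ≤ 9 := by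
  have hins := hK.2 q hq
  have hcage := insertion_le_of_clear (y := y) hclear
  set n : ℕ := (Finset.univ.filter fun k : Fin N => 39 / 40 ≤ dist q (y k) ∧ dist q (y k) ≤ 103 / 100).card with hn
  have hreal : (n : ℝ) < 10 := by linarith
  have : n < 10 := by exact_mod_cast hreal
  omega

/-- The same along a μ-stable configuration of any order `j ≥ 100` with tolerance `1/(j+1)` at a limit level `e` of `E(N)/N`:
μ-stability of order ≥ 100 excludes caged holes (orders 1 and 100 only enter through `kinkBalanced_of_muStable` and `1/(j+1) ≤ 1/100`). -/
theorem cagedCount_le_of_muStable {e : ℝ} (he : Tendsto (fun N : ℕ => groundStateEnergy lennardJones 3 N / N) atTop (𝓝 e))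
    {j : ℕ} (hj : 100 ≤ j) {y : Fin N → E3} (hy : Function.Injective y)
    (hM : (∀ M : ℕ, N ≤ M + j → M ≤ N + j → ∀ z : Fin M → E3, Function.Injective z →
      interactionEnergy lennardJones y + e * ((M : ℝ) - N) - 1 / ((j : ℝ) + 1) ≤ interactionEnergy lennardJones z))
    {q : E3} (hq : q ∉ Set.range y) (hclear : ∀ k : Fin N, 9 / 10 ≤ dist q (y k)) :
    (Finset.univ.filter fun k : Fin N => 39 / 40 ≤ dist q (y k) ∧ dist q (y k) ≤ 103 / 100).card ≤ 9 := by
  have hK := kinkBalanced_of_muStable hM (by omega) hy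
  refine cagedCount_le_of_kinkBalanced hK (twoConeB_le_of_tendsto he) ?_ hq hclear
  have hj' : (100 : ℝ) ≤ j := by exact_mod_cast hj
  rw [div_le_div_iff₀ (by positivity) (by norm_num)]
  linarith

end Summit.AtomisticToContinuum.Crystallization.Theorems.LoopTunnelDialLocalSurgery

end
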